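import Summits.HodgeConjecture.HodgeConjecture.Theorems.Ring2AbelianAllAndreFibreClassDivision
import HarnessLib

/-!
# Ring 2 · sub-cell AbelianAll (ALL ABELIAN VARIETIES), André axis, part XXIX-b — DIVISION BY THE FIBRE CLASS FOR EVERY
# SMOOTH PROJECTIVE FAMILY: Grothendieck's `A(𝒳, η)` (or `D(𝒳)` in two bidegrees) for the TOTAL SPACE ALONE implies that
# an invariant class algebraic on one fibre is the restriction of an algebraic class — any fibres; and the node rows

HONEST FRAMING (page 1, verbatim): **research route, not a corollary; conditional on HC_CM plus one named
minimal statement.** Cell line: research route conditional on HC_CM; not a corollary; Q11.4-sentence-2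
already refuted in dim ≥ 3. Nothing in this file proves a case of the Hodge conjecture for an abelian variety.
`HC_CM` = `Theses.RankFourFaces.CMAbelianHodge` does NOT occur in this file;
`HC_AV` = `Theses.PadicSemiregularLift.HodgeAbelianVarieties`; item `Theses.RankFourFaces.CMToAbelian`
(stmt-HodgeConjecture-16267) OPEN and not closed here. Seat `pub-hodge-ring2-ab-andre-2`, gen 21; continuation of part
XXIX-a (`Ring2AbelianAllAndreFibreClassDivision`), whose module docstring states the argument.

## What is proved (theorems only; no definition, no named fact, no sorry)

§1 node level for compact abelian pencils: **`cmFibreAlgebraicLift_of_cmPointedPencilStandardA_total`** — seat ab-andre-1's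
`CMPointedPencilStandardA` (`A(𝒳, η)` on the CM-pointed compact abelian pencil total spaces) gives the André-axis lift node
`CMFibreAlgebraicLift` with NO `HC_CM` and NO Lieberman (part XVIII-e took `HC_CM` for the fibre's (Perf_t);
`Ring2AbelianAllAndreLiebermanDischargedRows` used Lieberman's theorem); the row `HC_CM ∧ A_pen^CM ⟹ HC_AV` is part XVIII-e's
`HC_AV_of_HC_CM_of_cmPointedPencilStandardA` (not restated; `HC_CM` serves Lemme 6.3.1's transport there, not the lift).
§2 ANY smooth projective family `f : 𝒳 ⟶ S` of relative dimension `n` over a smooth projective base of dimension `m`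
(total space smooth projective of dimension `n + m`), a point `t`, `p + q = n`, `L_t := j_{t*} j_t^* : H^{2p}(𝒳) → H^{2p+2m}(𝒳)`:
`cupProduct_map_fiberι_eq_zero_iff_family` (`j_t^* a ∪ b = 0 ⟺ a ∪ j_{t*} b = 0`), `cupProduct_gysin_map_fiberι_eq_zero_iff_family`
(`L_t a ∪ w = 0 ⟺ a ∪ L_t w = 0`), **`exists_mem_algebraicClasses_map_fiberι_eq_of_numerical_family`** ((Num₁) ∧ (Num₂) ∧
`L_t x ∈ N^{p+m}(𝒳)` ⟹ `j_t^* x = j_t^* x'`, `x'` algebraic), **`comap_le_sup_of_nondegenerate_family`** (`D(𝒳)` in bidegrees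
`(p, q+m)` right / `(p+m, q)` left ⟹ `(j_t^*)⁻¹ N^p(𝒳_t) ≤ N^p(𝒳) + ker j_t^*`), **`comap_le_sup_of_standardConjectureA_family`**
(`A(𝒳, η)` for all polarisations ⟹ the same for every `t`, `p`) and its free-dimension form `…_family'`.
READING: for every smooth projective family over a smooth projective base, `A` (equivalently `D`) of the total space ALONE
gives "a monodromy-invariant class algebraic on ONE fibre is the restriction of an algebraic class of `𝒳`, hence algebraic
on EVERY fibre" — the variational statement for algebraic classes that print draws from `B(𝒳)` (André 1996 Thm. 0.5 with
Thm. 0.4) — with nothing assumed about the fibres (`D(𝒳_t)` unknown for K3 / Calabi–Yau / hyperkähler fibres is not needed).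

## Honest status

Nothing here is fact-free progress on `HC_AV`; no node is born; nothing is minimal; no separation of (Num₁)/(Num₂) from
`D(𝒳)` or of `A` from `B` is claimed. The observation "`A(𝒳)` of the total space suffices" is recorded as such, not as a
claim of novelty (see part XXIX-a's honest status).

References: Kleiman1968AlgebraicCycles (§3, Cor. 3.9); Grothendieck1968 (§3 p. 196); Andre1996Motifs (Thm. 0.4, 0.5, §5.1,
Lemme 6.3.1, Remarque 2); Milne2020HodgeClassesAV (Prop. 1 p. 7); Abdulali1994FamiliesAV (p. 1122); FultonYoungTableaux1997
(App. B (5)–(6)); HatcherAT2002 (§3.2 Thm. 3.11, §3.3 Prop. 3.38); DeligneHodgeII1971 (Thm. 4.1.1); VoisinHodgeII2003 (§4.3.1 Thm. 4.18).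
-/

noncomputable section

set_option linter.dupNamespace false

namespace Summit.HodgeConjecture.HodgeConjecture.Ring2.AbelianAll

open CategoryTheory AlgebraicGeometry
open Literature.AlgebraicGeometry Literature.AlgebraicGeometry.Motives
open Literature.AlgebraicGeometry.HodgeTheory
open Literature.AlgebraicTopology.SingularHomology (singularCohomology cupProduct cupProduct_gradedComm_holds
  gysinMap_restrictCompl_eq_zero_of_field)
open Summit.HodgeConjecture.HodgeConjecture.Theorems (fulton1998_map_mem_algebraicClasses_holds)

variable {𝒳 S : SchemeOver ℂ}

/-! ## §1 Node level (compact abelian pencils): `A_pen^CM ⟹ (L)` with no `HC_CM` and no Lieberman -/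

/-- **`A_pen^CM ⟹ (L)` WITHOUT `HC_CM` AND WITHOUT LIEBERMAN** (node level): seat ab-andre-1's `CMPointedPencilStandardA`
gives the André-axis lift node `CMFibreAlgebraicLift` outright (part XVIII-e's `cmFibreAlgebraicLift_of_HC_CM_of_cmPointedPencilStandardA`
took `HC_CM` as a binder, for (Perf_t) at the CM fibre). [cite: Milne2020HodgeClassesAV, Prop. 1 (p. 7)]
[cite: Andre1996Motifs, §6.3 Remarque 2 (p. 33)] -/
theorem cmFibreAlgebraicLift_of_cmPointedPencilStandardA_total (hA : CMPointedPencilStandardA) : CMFibreAlgebraicLift := by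
  rw [cmFibreAlgebraicLift_iff_comap_le_sup]
  intro d 𝒳 S f hf p t ht
  obtain ⟨A₀, ⟨e₀⟩, -, hcm⟩ := ht
  exact comap_le_sup_of_standardConjectureA_total hf (hA f hf ⟨t, A₀, ⟨e₀⟩, hcm⟩) p t

-- The row `HC_CM ∧ A_pen^CM ⟹ HC_AV` is part XVIII-e's `HC_AV_of_HC_CM_of_cmPointedPencilStandardA` (same statement; by the
-- theorem above it now has a fibre-free proof: `HC_AV_of_HC_CM_and_cmFibreAlgebraicLift h₂₁ hCM (… hA)`); not restated.

/-! ## §2 Every smooth projective family over a smooth projective base (any relative and base dimension) -/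

section Family

variable {n m : ℕ} {f : 𝒳 ⟶ S}

/-- **`j_t^* a ∪ b = 0 ⟺ a ∪ j_{t*} b = 0`** for a smooth projective family `f : 𝒳 ⟶ S` of relative dimension `n` over a
smooth projective base of dimension `m` (`a ∈ H^{2p}(𝒳)`, `b ∈ H^{2q}(𝒳_t)`, `p + q = n`): projection formula
`j_{t*}(j_t^* a ∪ b) = a ∪ j_{t*} b` (the tree's `complexGysin_cup`) and injectivity of `j_{t*}` on the top degree of the
fibre (part XII-c). [cite: FultonYoungTableaux1997, Appendix B §B.1 (6)] [cite: HatcherAT2002, §3.3 Prop. 3.38] -/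
theorem cupProduct_map_fiberι_eq_zero_iff_family (hS : IsSmoothProjective m S) (hf : IsSmoothProjectiveFamily f n)
    (h𝒳 : IsSmoothProjective (n + m) 𝒳) (t : ComplexPoints S) {p q : ℕ} (hpq : p + q = n)
    (a : complexBetti 𝒳 (2 * p)) (b : complexBetti (fiberOver f t) (2 * q)) :
    cupProduct (show 2 * p + 2 * q = 2 * n by omega) (complexBetti.map (fiberι f t) (2 * p) a) b = 0 ↔
      cupProduct (show 2 * p + 2 * (q + m) = 2 * (n + m) by omega) a
        (complexGysin complexOrientationFamily (hf.isSmoothProjective t) h𝒳 (fiberι f t)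
          (show 2 * q + 2 * (n + m) = 2 * (q + m) + 2 * n by omega) b) = 0 := by
  have hproj := complexGysin_cup (μ := complexOrientationFamily) hasPoincareDuality_complexOrientationFamily
    (hf.isSmoothProjective t) h𝒳 (fiberι f t) (show 2 * p + 2 * q = 2 * n by omega)
    (show 2 * n + 2 * (n + m) = 2 * (n + m) + 2 * n by ring)
    (show 2 * q + 2 * (n + m) = 2 * (q + m) + 2 * n by omega)
    (show 2 * p + 2 * (q + m) = 2 * (n + m) by omega) a b
  rw [← hproj]
  exact ⟨fun h ↦ by rw [h, map_zero], fun h ↦ complexGysin_fiberι_top_injective hS hf h𝒳 t h⟩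

/-- **Symmetry of `L_t = j_{t*} j_t^*`, general family: `L_t a ∪ w = 0 ⟺ a ∪ L_t w = 0`** (`a ∈ H^{2p}(𝒳)`,
`w ∈ H^{2q}(𝒳)`, `p + q = n`). [cite: FultonYoungTableaux1997, Appendix B §B.1 (6)] [cite: HatcherAT2002, §3.2 Thm. 3.11] -/
theorem cupProduct_gysin_map_fiberι_eq_zero_iff_family (hS : IsSmoothProjective m S) (hf : IsSmoothProjectiveFamily f n)
    (h𝒳 : IsSmoothProjective (n + m) 𝒳) (t : ComplexPoints S) {p q : ℕ} (hpq : p + q = n)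
    (a : complexBetti 𝒳 (2 * p)) (w : complexBetti 𝒳 (2 * q)) :
    cupProduct (show 2 * (p + m) + 2 * q = 2 * (n + m) by omega)
        (complexGysin complexOrientationFamily (hf.isSmoothProjective t) h𝒳 (fiberι f t)
          (show 2 * p + 2 * (n + m) = 2 * (p + m) + 2 * n by omega) (complexBetti.map (fiberι f t) (2 * p) a)) w = 0 ↔
      cupProduct (show 2 * p + 2 * (q + m) = 2 * (n + m) by omega) a
        (complexGysin complexOrientationFamily (hf.isSmoothProjective t) h𝒳 (fiberι f t)
          (show 2 * q + 2 * (n + m) = 2 * (q + m) + 2 * n by omega) (complexBetti.map (fiberι f t) (2 * q) w)) = 0 := by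
  have h1 : cupProduct (show 2 * (p + m) + 2 * q = 2 * (n + m) by omega)
        (complexGysin complexOrientationFamily (hf.isSmoothProjective t) h𝒳 (fiberι f t)
          (show 2 * p + 2 * (n + m) = 2 * (p + m) + 2 * n by omega) (complexBetti.map (fiberι f t) (2 * p) a)) w =
      cupProduct (show 2 * q + 2 * (p + m) = 2 * (n + m) by omega) w
        (complexGysin complexOrientationFamily (hf.isSmoothProjective t) h𝒳 (fiberι f t)
          (show 2 * p + 2 * (n + m) = 2 * (p + m) + 2 * n by omega) (complexBetti.map (fiberι f t) (2 * p) a)) := by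
    rw [cupProduct_gradedComm_holds ℂ (ComplexPoints 𝒳) (show 2 * (p + m) + 2 * q = 2 * (n + m) by omega)
      (show 2 * q + 2 * (p + m) = 2 * (n + m) by omega), Even.neg_one_pow ⟨2 * (p + m) * q, by ring⟩, one_smul]
  have h2 : cupProduct (show 2 * q + 2 * p = 2 * n by omega) (complexBetti.map (fiberι f t) (2 * q) w)
        (complexBetti.map (fiberι f t) (2 * p) a) =
      cupProduct (show 2 * p + 2 * q = 2 * n by omega) (complexBetti.map (fiberι f t) (2 * p) a)
        (complexBetti.map (fiberι f t) (2 * q) w) := by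
    rw [cupProduct_gradedComm_holds ℂ (ComplexPoints (fiberOver f t)) (show 2 * q + 2 * p = 2 * n by omega)
      (show 2 * p + 2 * q = 2 * n by omega), Even.neg_one_pow ⟨2 * q * p, by ring⟩, one_smul]
  rw [h1, ← cupProduct_map_fiberι_eq_zero_iff_family hS hf h𝒳 t (show q + p = n by omega) w
      (complexBetti.map (fiberι f t) (2 * p) a), h2,
    cupProduct_map_fiberι_eq_zero_iff_family hS hf h𝒳 t hpq a (complexBetti.map (fiberι f t) (2 * q) w)]

/-- **DIVISION BY THE FIBRE CLASS — EVERY SMOOTH PROJECTIVE FAMILY.** For `f : 𝒳 ⟶ S` smooth projective of relative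
dimension `n` over a smooth projective base of dimension `m`, a point `t`, `p + q = n`, `L_t := j_{t*} j_t^*`
(`H^{2p}(𝒳) → H^{2p+2m}(𝒳)`, cup product with the fibre class): (Num₁) ∧ (Num₂) (module docstring, degrees shifted by
`m`) and `L_t x ∈ N^{p+m}(𝒳)` give an ALGEBRAIC `x'` with `j_t^* x' = j_t^* x`. The proof is that of
`exists_mem_algebraicClasses_map_fiberι_eq_of_numerical` word for word (Gysin push-forward and pull-back of algebraic
classes, Deligne's kernel identity κ̂ — tree theorems for every such family); the cohomology of the fibre is never used.
[cite: Kleiman1968AlgebraicCycles, §3 (D(X))] [cite: DeligneHodgeII1971, Thm. 4.1.1] [cite: VoisinHodgeII2003, §4.3.1 Thm. 4.18] -/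
theorem exists_mem_algebraicClasses_map_fiberι_eq_of_numerical_family (hS : IsSmoothProjective m S)
    (hf : IsSmoothProjectiveFamily f n) (h𝒳 : IsSmoothProjective (n + m) 𝒳) (t : ComplexPoints S) {p q : ℕ}
    (hpq : p + q = n)
    (hNum₁ : ∀ w ∈ algebraicClasses 𝒳 q,
      (∀ a ∈ algebraicClasses 𝒳 p, cupProduct (show 2 * p + 2 * (q + m) = 2 * (n + m) by omega) a
          (complexGysin complexOrientationFamily (hf.isSmoothProjective t) h𝒳 (fiberι f t)
            (show 2 * q + 2 * (n + m) = 2 * (q + m) + 2 * n by omega) (complexBetti.map (fiberι f t) (2 * q) w)) = 0) →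
        complexGysin complexOrientationFamily (hf.isSmoothProjective t) h𝒳 (fiberι f t)
          (show 2 * q + 2 * (n + m) = 2 * (q + m) + 2 * n by omega) (complexBetti.map (fiberι f t) (2 * q) w) = 0)
    (hNum₂ : ∀ x : complexBetti 𝒳 (2 * p),
      complexGysin complexOrientationFamily (hf.isSmoothProjective t) h𝒳 (fiberι f t)
          (show 2 * p + 2 * (n + m) = 2 * (p + m) + 2 * n by omega) (complexBetti.map (fiberι f t) (2 * p) x) ∈
        algebraicClasses 𝒳 (p + m) →
      (∀ w ∈ algebraicClasses 𝒳 q, cupProduct (show 2 * (p + m) + 2 * q = 2 * (n + m) by omega)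
          (complexGysin complexOrientationFamily (hf.isSmoothProjective t) h𝒳 (fiberι f t)
            (show 2 * p + 2 * (n + m) = 2 * (p + m) + 2 * n by omega) (complexBetti.map (fiberι f t) (2 * p) x)) w = 0) →
        complexGysin complexOrientationFamily (hf.isSmoothProjective t) h𝒳 (fiberι f t)
          (show 2 * p + 2 * (n + m) = 2 * (p + m) + 2 * n by omega) (complexBetti.map (fiberι f t) (2 * p) x) = 0)
    {x : complexBetti 𝒳 (2 * p)}
    (hx : complexGysin complexOrientationFamily (hf.isSmoothProjective t) h𝒳 (fiberι f t)
      (show 2 * p + 2 * (n + m) = 2 * (p + m) + 2 * n by omega) (complexBetti.map (fiberι f t) (2 * p) x) ∈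
        algebraicClasses 𝒳 (p + m)) :
    ∃ x' ∈ algebraicClasses 𝒳 p,
      complexBetti.map (fiberι f t) (2 * p) x' = complexBetti.map (fiberι f t) (2 * p) x := by
  have hY := hf.isSmoothProjective t
  haveI : Module.Finite ℂ (complexBetti 𝒳 (2 * q)) := finite_complexBetti h𝒳 _
  set G := complexGysin complexOrientationFamily hY h𝒳 (fiberι f t)
    (show 2 * p + 2 * (n + m) = 2 * (p + m) + 2 * n by omega) with hG
  set L : complexBetti 𝒳 (2 * p) →ₗ[ℂ] complexBetti 𝒳 (2 * (p + m)) :=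
    G ∘ₗ (complexBetti.map (fiberι f t) (2 * p)).hom with hL
  have hLapply : ∀ y, L y = G (complexBetti.map (fiberι f t) (2 * p) y) := fun y ↦ rfl
  have hLalg : ∀ y ∈ algebraicClasses 𝒳 p, L y ∈ algebraicClasses 𝒳 (p + m) := fun y hy ↦
    complexGysin_mem_algebraicClasses (gysinMap_restrictCompl_eq_zero_of_field ℂ) complexOrientationFamily
      hasPoincareDuality_complexOrientationFamily hY h𝒳 (fiberι f t) (show p + (n + m) = p + m + n by omega)
      (show 2 * p + 2 * (n + m) = 2 * (p + m) + 2 * n by omega)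
      (fulton1998_map_mem_algebraicClasses_holds (fiberι f t) h𝒳 hY p y hy)
  have hmem : L x ∈ (algebraicClasses 𝒳 p).map L := by
    have hline : Module.finrank ℂ (complexBetti 𝒳 (2 * (n + m))) = 1 := finrank_complexBetti_two_mul_eq_one h𝒳
    refine mem_of_forall_orthogonal_of_left_nondegenerate'
      (cupProduct (show 2 * (p + m) + 2 * q = 2 * (n + m) by omega)) hline
      (A := algebraicClasses 𝒳 (p + m) ⊓ LinearMap.range L) (A' := algebraicClasses 𝒳 q)
      (fun a ha hab ↦ ?_) ?_ (Submodule.mem_inf.2 ⟨hx, LinearMap.mem_range_self L x⟩) fun w hw hwV ↦ ?_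
    · obtain ⟨ha₁, ha₂⟩ := Submodule.mem_inf.1 ha
      obtain ⟨x₀, rfl⟩ := LinearMap.mem_range.1 ha₂
      exact hNum₂ x₀ ha₁ hab
    · rintro _ ⟨y, hy, rfl⟩
      exact Submodule.mem_inf.2 ⟨hLalg y hy, LinearMap.mem_range_self L y⟩
    · have hLw : complexGysin complexOrientationFamily hY h𝒳 (fiberι f t)
          (show 2 * q + 2 * (n + m) = 2 * (q + m) + 2 * n by omega) (complexBetti.map (fiberι f t) (2 * q) w) = 0 := by
        refine hNum₁ w hw fun a ha ↦ ?_
        rw [← cupProduct_gysin_map_fiberι_eq_zero_iff_family hS hf h𝒳 t hpq a w]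
        exact hwV _ (Submodule.mem_map_of_mem ha)
      rw [hLapply, hG, cupProduct_gysin_map_fiberι_eq_zero_iff_family hS hf h𝒳 t hpq x w, hLw, map_zero]
  obtain ⟨x', hx', hLx'⟩ := Submodule.mem_map.1 hmem
  refine ⟨x', hx', ?_⟩
  have h0 : G (complexBetti.map (fiberι f t) (2 * p) (x' - x)) = 0 := by
    rw [map_sub, map_sub]
    exact sub_eq_zero.2 hLx'
  have h := deligne1971_fibreGysin_injOn_restricted_holds f hS hf h𝒳
    (show 2 * p + 2 * (n + m) = 2 * (p + m) + 2 * n by omega) t (x' - x) h0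
  rwa [map_sub, sub_eq_zero] at h

/-- **THE LIFT FROM `D(𝒳)` IN TWO BIDEGREES — EVERY SMOOTH PROJECTIVE FAMILY**: trivial right kernel of
`N^p(𝒳) × N^{q+m}(𝒳) → H^{2n+2m}` and trivial left kernel of `N^{p+m}(𝒳) × N^q(𝒳) → H^{2n+2m}` (`p + q = n`) give
`(j_t^*)⁻¹ N^p(𝒳_t) ≤ N^p(𝒳) + ker j_t^*`: a class of the total space algebraic on ONE fibre is algebraic on `𝒳` up
to `ker j_t^*` (and so algebraic on EVERY fibre). Nothing is assumed about the fibres.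
[cite: Kleiman1968AlgebraicCycles, §3 (D(X))] [cite: Andre1996Motifs, §5.1 and Thm. 0.5] -/
theorem comap_le_sup_of_nondegenerate_family (hS : IsSmoothProjective m S) (hf : IsSmoothProjectiveFamily f n)
    (h𝒳 : IsSmoothProjective (n + m) 𝒳) (t : ComplexPoints S) {p q : ℕ} (hpq : p + q = n)
    (hD₁ : ∀ b ∈ algebraicClasses 𝒳 (q + m),
      (∀ a ∈ algebraicClasses 𝒳 p, cupProduct (show 2 * p + 2 * (q + m) = 2 * (n + m) by omega) a b = 0) → b = 0)
    (hD₂ : ∀ a ∈ algebraicClasses 𝒳 (p + m),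
      (∀ b ∈ algebraicClasses 𝒳 q, cupProduct (show 2 * (p + m) + 2 * q = 2 * (n + m) by omega) a b = 0) → a = 0) :
    (algebraicClasses (fiberOver f t) p).comap (complexBetti.map (fiberι f t) (2 * p)).hom ≤
      algebraicClasses 𝒳 p ⊔ LinearMap.ker (complexBetti.map (fiberι f t) (2 * p)).hom := by
  have hY := hf.isSmoothProjective t
  intro W hW
  have hW' : complexBetti.map (fiberι f t) (2 * p) W ∈ algebraicClasses (fiberOver f t) p := hW
  obtain ⟨x', hx', hxW⟩ := exists_mem_algebraicClasses_map_fiberι_eq_of_numerical_family hS hf h𝒳 t hpq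
    (fun _ hw h ↦ hD₁ _ (complexGysin_mem_algebraicClasses (gysinMap_restrictCompl_eq_zero_of_field ℂ) complexOrientationFamily
      hasPoincareDuality_complexOrientationFamily hY h𝒳
      (fiberι f t) (show q + (n + m) = q + m + n by omega) (show 2 * q + 2 * (n + m) = 2 * (q + m) + 2 * n by omega)
      (fulton1998_map_mem_algebraicClasses_holds (fiberι f t) h𝒳 hY q _ hw)) h)
    (fun _ hx h ↦ hD₂ _ hx h)
    (complexGysin_mem_algebraicClasses (gysinMap_restrictCompl_eq_zero_of_field ℂ) complexOrientationFamily
      hasPoincareDuality_complexOrientationFamily hY h𝒳 (fiberι f t) (show p + (n + m) = p + m + n by omega)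
      (show 2 * p + 2 * (n + m) = 2 * (p + m) + 2 * n by omega) hW')
  rw [show W = x' + (W - x') by abel]
  refine Submodule.add_mem_sup hx' ?_
  rw [LinearMap.mem_ker, map_sub, sub_eq_zero]
  exact hxW.symm

/-- **GROTHENDIECK'S `A(𝒳, η)` FOR THE TOTAL SPACE ALONE GIVES THE VARIATIONAL STATEMENT FOR ALGEBRAIC CLASSES — EVERY
SMOOTH PROJECTIVE FAMILY, ANY FIBRES**: if `A(𝒳, η)` holds for every polarisation class of the smooth projective total
space `𝒳` (equivalently `D(𝒳)`, Kleiman), then for every point `t` and every `p`, every class of `H^{2p}(𝒳(ℂ); ℂ)`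
algebraic on the fibre `𝒳_t` lies in `N^p(𝒳) + ker j_t^*`; in particular a monodromy-invariant class algebraic on ONE
fibre is the restriction of an algebraic class of `𝒳`, hence algebraic on every fibre. In print this conclusion is drawn
from `B(𝒳)` (André 1996, Thm. 0.5 with Thm. 0.4); no hypothesis on the fibres (`D(𝒳_t)` is not used).
[cite: Grothendieck1968, §3 p. 196] [cite: Kleiman1968AlgebraicCycles, §3 Cor. 3.9] [cite: Andre1996Motifs, Thm. 0.5 and §5.1] -/
theorem comap_le_sup_of_standardConjectureA_family (hS : IsSmoothProjective m S) (hf : IsSmoothProjectiveFamily f n)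
    (h𝒳 : IsSmoothProjective (n + m) 𝒳)
    (hA : ∀ η : complexBetti 𝒳 2, IsPolarizationClass (n + m) 𝒳 η → StandardConjectureA (n + m) 𝒳 η)
    (p : ℕ) (t : ComplexPoints S) :
    (algebraicClasses (fiberOver f t) p).comap (complexBetti.map (fiberι f t) (2 * p)).hom ≤
      algebraicClasses 𝒳 p ⊔ LinearMap.ker (complexBetti.map (fiberι f t) (2 * p)).hom := by
  rcases le_or_gt p n with hp | hp
  · have h1 := nondegenerate_algebraicClasses_of_standardConjectureA h𝒳 hA (show p + (n - p + m) = n + m by omega)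
    have h2 := nondegenerate_algebraicClasses_of_standardConjectureA h𝒳 hA (show (p + m) + (n - p) = n + m by omega)
    exact comap_le_sup_of_nondegenerate_family hS hf h𝒳 t (show p + (n - p) = n by omega) h1.2 h2.1
  · intro W _
    haveI := subsingleton_complexBetti (hf.isSmoothProjective t) (show 2 * n < 2 * p by omega)
    refine Submodule.mem_sup_right ?_
    rw [LinearMap.mem_ker]
    exact Subsingleton.elim _ _

/-- The same with the dimension of the total space a free parameter `N` (`N = n + m` by the tree's dimension count,
part XII-c `dim_total_eq_add`). [cite: Grothendieck1968, §3 p. 196] [cite: Kleiman1968AlgebraicCycles, §3 Cor. 3.9] -/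
theorem comap_le_sup_of_standardConjectureA_family' {N : ℕ} (hS : IsSmoothProjective m S)
    (hf : IsSmoothProjectiveFamily f n) (h𝒳 : IsSmoothProjective N 𝒳)
    (hA : ∀ η : complexBetti 𝒳 2, IsPolarizationClass N 𝒳 η → StandardConjectureA N 𝒳 η)
    (p : ℕ) (t : ComplexPoints S) :
    (algebraicClasses (fiberOver f t) p).comap (complexBetti.map (fiberι f t) (2 * p)).hom ≤
      algebraicClasses 𝒳 p ⊔ LinearMap.ker (complexBetti.map (fiberι f t) (2 * p)).hom := by
  obtain rfl : N = n + m := dim_total_eq_add hS hf h𝒳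
  exact comap_le_sup_of_standardConjectureA_family hS hf h𝒳 hA p t

end Family

end Summit.HodgeConjecture.HodgeConjecture.Ring2.AbelianAll

end
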